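import Mathlib.Analysis.SpecialFunctions.Exponential
import Mathlib.Analysis.Calculus.InverseFunctionTheorem.FDeriv
import Mathlib.NumberTheory.Padics.PadicNumbers
import Mathlib.Analysis.Normed.Field.Ultra
import Mathlib.Analysis.Normed.Group.Ultra
import HarnessLib

/-!
# The `ℓ`-adic exponential on the ball `‖a‖ < ℓ⁻¹` of an ultrametric Banach `ℚ_ℓ`-algebra field

Everything in this file is **proved**; there are no definitions.  Let `ℓ` be a prime and `E` a
complete non-archimedean normed field which is a normed `ℚ_ℓ`-algebra (e.g. a finite extension of
`ℚ_ℓ` with the spectral norm, or `ℂ_ℓ`).  For Mathlib's exponential `NormedSpace.exp : E → E`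
(the sum of `∑ aⁿ/n!`) we prove, on the ball `B = {a : ‖a‖ < ℓ⁻¹}` (which lies inside the disc
of convergence `‖a‖ < ℓ^{-1/(ℓ-1)}`, and equals it for `ℓ = 2`):

* `PadicExp.le_expSeries_radius` — `ℓ⁻¹ ≤` radius of convergence (Legendre: `v_ℓ(n!) ≤ n - 1`);
* `PadicExp.exp_add` — `exp (a + b) = exp a · exp b` on `B` (Mathlib, functional equation);
* `PadicExp.norm_exp_sub_one_sub_self_le`, `PadicExp.norm_exp_sub_one`, `PadicExp.norm_exp` —
  `‖exp a - 1 - a‖ ≤ ℓ ‖a‖² < ‖a‖`, `‖exp a - 1‖ = ‖a‖`, `‖exp a‖ = 1`;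
* `PadicExp.exp_injOn` — `exp` is injective on `B` (no `2πi` in the `ℓ`-adic world);
* `PadicExp.exp_natCast_mul`, `PadicExp.exp_neg`, `PadicExp.exp_intCast_mul` — `exp (n a) = (exp a)ⁿ`;
* `PadicExp.hasSum_exp`, `PadicExp.continuousOn_exp` — the series and continuity on `B`;
* `PadicExp.exists_forall_exists_exp_eq` — **local surjectivity at `1`**: every `w` close
  enough to `1` is `exp c` with `c` as small as desired (inverse function theorem, Mathlib
  `HasStrictFDerivAt.map_nhds_eq_of_equiv` with `hasStrictFDerivAt_exp_zero_of_radius_pos`).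

These are the analytic inputs of the `ℓ`-adic six exponentials theorem
(`SixExponentialsPadicProofs.lean`) and of the local algebraicity of `ℓ`-adic characters with
algebraic values (Lang–Serre; `PadicCharacterLocallyAlgebraicProofs.lean`).

## References

* N. Koblitz, *p-adic Numbers, p-adic Analysis, and Zeta-Functions*, GTM 58, Ch. IV §1
  (`exp_p`, `log_p`, radius `p^{-1/(p-1)}`, isometry on the ball).
* A. M. Robert, *A Course in p-adic Analysis*, GTM 198, Ch. 5 §4.1–4.2.
-/

noncomputable section

open NormedSpace Filter Topology Metric
open scoped ENNReal NNReal Nat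

namespace Literature.NumberTheory.Transcendental

namespace PadicExp

variable {ℓ : ℕ} [Fact ℓ.Prime]

/-! ### Norms of integers and factorials -/

/-- `‖(n!)⁻¹‖_ℓ ≤ ℓ^{n-1}` (Legendre: `(ℓ - 1) v_ℓ(n!) < n`). [folklore] -/
theorem norm_inv_natCast_factorial_padic_le (n : ℕ) :
    ‖((n ! : ℕ) : ℚ_[ℓ])⁻¹‖ ≤ (ℓ : ℝ) ^ (n - 1) := by
  have hp : ℓ.Prime := Fact.out
  have hne : ((n ! : ℕ) : ℚ_[ℓ]) ≠ 0 := by exact_mod_cast n.factorial_ne_zero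
  rw [norm_inv, Padic.norm_eq_zpow_neg_valuation hne, Padic.valuation_natCast, zpow_neg, inv_inv,
    zpow_natCast]
  refine pow_le_pow_right₀ (by exact_mod_cast hp.one_lt.le) ?_
  rcases Nat.eq_zero_or_pos n with rfl | hn
  · simp
  · have h := sub_one_mul_padicValNat_factorial_lt_of_ne_zero ℓ hn.ne'
    have h1 : 1 ≤ ℓ - 1 := by have := hp.two_le; omega
    have h2 : padicValNat ℓ n ! ≤ (ℓ - 1) * padicValNat ℓ n ! := Nat.le_mul_of_pos_left _ h1
    omega

variable {E : Type*} [NontriviallyNormedField E] [NormedAlgebra ℚ_[ℓ] E]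

/-- `‖n‖_E = ‖n‖_ℓ` for a natural number `n`. [folklore] -/
theorem norm_natCast (n : ℕ) : ‖(n : E)‖ = ‖(n : ℚ_[ℓ])‖ := by
  rw [← map_natCast (algebraMap ℚ_[ℓ] E), norm_algebraMap']

include ℓ in
/-- `‖n‖_E ≤ 1` for a natural number `n` (in any normed `ℚ_ℓ`-algebra field `E`). [folklore] -/
theorem norm_natCast_le_one (n : ℕ) : ‖(n : E)‖ ≤ 1 := by
  rw [norm_natCast (ℓ := ℓ)]
  exact_mod_cast Padic.norm_int_le_one (p := ℓ) (n : ℤ)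

include ℓ in
/-- `‖z‖_E ≤ 1` for an integer `z` (in any normed `ℚ_ℓ`-algebra field `E`). [folklore] -/
theorem norm_intCast_le_one (z : ℤ) : ‖(z : E)‖ ≤ 1 := by
  rw [← map_intCast (algebraMap ℚ_[ℓ] E), norm_algebraMap']
  exact Padic.norm_int_le_one z

/-- `‖ℓ‖_E = ℓ⁻¹`. [folklore] -/
theorem norm_natCast_prime : ‖(ℓ : E)‖ = (ℓ : ℝ)⁻¹ := by
  rw [norm_natCast (ℓ := ℓ), Padic.norm_p]

/-- `‖(n!)⁻¹‖_E ≤ ℓ^{n-1}`. [folklore] -/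
theorem norm_inv_natCast_factorial_le (n : ℕ) :
    ‖((n ! : ℕ) : E)⁻¹‖ ≤ (ℓ : ℝ) ^ (n - 1) := by
  rw [norm_inv, norm_natCast (ℓ := ℓ), ← norm_inv]
  exact norm_inv_natCast_factorial_padic_le n

/-- The general term: `‖aⁿ / n!‖ ≤ ‖a‖ⁿ ℓ^{n-1}`. [folklore] -/
theorem norm_pow_div_factorial_le (a : E) (n : ℕ) :
    ‖a ^ n / (n ! : E)‖ ≤ ‖a‖ ^ n * (ℓ : ℝ) ^ (n - 1) := by
  rw [div_eq_mul_inv, norm_mul, norm_pow]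
  refine mul_le_mul_of_nonneg_left ?_ (pow_nonneg (norm_nonneg _) _)
  exact_mod_cast norm_inv_natCast_factorial_le (ℓ := ℓ) (E := E) n

/-- On the ball: `‖aⁿ / n!‖ ≤ ‖a‖ (ℓ ‖a‖)^{n-1} ≤ ‖a‖` for `n ≥ 1`, `‖a‖ < ℓ⁻¹`. [folklore] -/
theorem norm_pow_div_factorial_le_mul_pow {a : E} (n : ℕ) (hn : 1 ≤ n) :
    ‖a ^ n / (n ! : E)‖ ≤ ‖a‖ * (‖a‖ * ℓ) ^ (n - 1) := by
  refine (norm_pow_div_factorial_le (ℓ := ℓ) a n).trans_eq ?_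
  conv_lhs => rw [← Nat.sub_add_cancel hn, pow_succ]
  rw [Nat.add_sub_cancel, mul_pow]
  ring

/-! ### The radius of convergence -/

/-- **`ℓ⁻¹ ≤` radius of convergence of the exponential series** over `ℚ_ℓ`
(`‖expSeries n‖ ≤ ‖(n!)⁻¹‖_ℓ ≤ ℓ^{n-1}`). [folklore] -/
theorem le_expSeries_radius : (((ℓ : ℝ≥0)⁻¹ : ℝ≥0) : ℝ≥0∞) ≤ (expSeries ℚ_[ℓ] E).radius := by
  have hp : ℓ.Prime := Fact.out
  have hℓ : (0 : ℝ) < ℓ := by exact_mod_cast hp.pos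
  refine FormalMultilinearSeries.le_radius_of_bound _ 1 fun n => ?_
  have h1 : ‖expSeries ℚ_[ℓ] E n‖ ≤ (ℓ : ℝ) ^ (n - 1) := by
    rw [expSeries, norm_smul, ContinuousMultilinearMap.norm_mkPiAlgebraFin, mul_one]
    have : ((n !⁻¹ : ℚ_[ℓ])) = ((n ! : ℕ) : ℚ_[ℓ])⁻¹ := by norm_cast
    rw [this]
    exact norm_inv_natCast_factorial_padic_le n
  have h2 : (((ℓ : ℝ≥0)⁻¹ : ℝ≥0) : ℝ) ^ n = ((ℓ : ℝ) ^ n)⁻¹ := by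
    rw [NNReal.coe_inv, NNReal.coe_natCast, inv_pow]
  rw [h2]
  calc ‖expSeries ℚ_[ℓ] E n‖ * ((ℓ : ℝ) ^ n)⁻¹ ≤ (ℓ : ℝ) ^ (n - 1) * ((ℓ : ℝ) ^ n)⁻¹ :=
        mul_le_mul_of_nonneg_right h1 (by positivity)
    _ ≤ (ℓ : ℝ) ^ n * ((ℓ : ℝ) ^ n)⁻¹ := by
        gcongr
        · exact_mod_cast hp.one_lt.le
        · exact Nat.sub_le n 1
    _ = 1 := mul_inv_cancel₀ (by positivity)

/-- Points of the ball `‖a‖ < ℓ⁻¹` lie in the disc of convergence. [folklore] -/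
theorem mem_eball {a : E} (ha : ‖a‖ < (ℓ : ℝ)⁻¹) :
    a ∈ eball (0 : E) (expSeries ℚ_[ℓ] E).radius := by
  rw [mem_eball_zero_iff]
  refine lt_of_lt_of_le ?_ le_expSeries_radius
  have hp : ℓ.Prime := Fact.out
  have h0 : (ℓ : ℝ≥0) ≠ 0 := by exact_mod_cast hp.ne_zero
  rw [enorm_eq_nnnorm, ENNReal.coe_lt_coe, ← NNReal.coe_lt_coe, coe_nnnorm, NNReal.coe_inv,
    NNReal.coe_natCast]
  exact ha

/-- The radius of convergence is positive. [folklore] -/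
theorem expSeries_radius_pos : 0 < (expSeries ℚ_[ℓ] E).radius := by
  refine lt_of_lt_of_le ?_ le_expSeries_radius
  have hp : ℓ.Prime := Fact.out
  have h0 : (0 : ℝ≥0) < (ℓ : ℝ≥0) := by exact_mod_cast hp.pos
  exact ENNReal.coe_pos.2 (inv_pos.2 h0)

/-! ### The functional equation and the series -/

section Complete

variable [CompleteSpace E]

/-- **`exp (a + b) = exp a · exp b`** on the ball `‖·‖ < ℓ⁻¹`. [folklore] -/
theorem exp_add {a b : E} (ha : ‖a‖ < (ℓ : ℝ)⁻¹) (hb : ‖b‖ < (ℓ : ℝ)⁻¹) :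
    exp (a + b) = exp a * exp b :=
  exp_add_of_mem_ball (mem_eball ha) (mem_eball hb)

/-- The exponential series: `exp a = ∑ aⁿ / n!` on the ball. [folklore] -/
theorem hasSum_exp {a : E} (ha : ‖a‖ < (ℓ : ℝ)⁻¹) :
    HasSum (fun n : ℕ => a ^ n / (n ! : E)) (exp a) := by
  have h := expSeries_hasSum_exp_of_mem_ball' (𝕂 := ℚ_[ℓ]) a (mem_eball ha)
  refine h.congr_fun fun n => ?_
  rw [inv_natCast_smul_eq ℚ_[ℓ] E, smul_eq_mul, div_eq_mul_inv, mul_comm]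

/-- `exp a = ∑' aⁿ / n!` on the ball. [folklore] -/
theorem exp_eq_tsum {a : E} (ha : ‖a‖ < (ℓ : ℝ)⁻¹) :
    exp a = ∑' n : ℕ, a ^ n / (n ! : E) :=
  (hasSum_exp ha).tsum_eq.symm

/-- `exp` is continuous on the ball. [folklore] -/
theorem continuousOn_exp : ContinuousOn (exp : E → E) {a : E | ‖a‖ < (ℓ : ℝ)⁻¹} :=
  (NormedSpace.continuousOn_exp (𝕂 := ℚ_[ℓ])).mono fun _ ha => mem_eball ha

/-- `exp (n a) = (exp a)ⁿ` for `n ∈ ℕ` on the ball. [folklore] -/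
theorem exp_natCast_mul {a : E} (ha : ‖a‖ < (ℓ : ℝ)⁻¹) (n : ℕ) :
    exp ((n : E) * a) = exp a ^ n := by
  induction n with
  | zero => simp
  | succ n ih =>
    have hn : ‖(n : E) * a‖ < (ℓ : ℝ)⁻¹ := by
      rw [norm_mul]
      exact (mul_le_of_le_one_left (norm_nonneg _) (norm_natCast_le_one (ℓ := ℓ) n)).trans_lt ha
    rw [Nat.cast_succ, add_mul, one_mul, exp_add hn ha, ih, pow_succ]

end Complete

/-! ### Ultrametric estimates -/

section Ultra

variable [IsUltrametricDist E] [CompleteSpace E]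

/-- **`‖exp a - 1 - a‖ ≤ ℓ ‖a‖²`** on the ball `‖a‖ < ℓ⁻¹` (every term `aⁿ/n!`, `n ≥ 2`, has
norm `≤ ‖a‖ (ℓ‖a‖)^{n-1} ≤ ℓ‖a‖²`). [folklore] -/
theorem norm_exp_sub_one_sub_self_le {a : E} (ha : ‖a‖ < (ℓ : ℝ)⁻¹) :
    ‖exp a - 1 - a‖ ≤ ‖a‖ * (‖a‖ * ℓ) := by
  have hp : ℓ.Prime := Fact.out
  have hℓ : (0 : ℝ) < ℓ := by exact_mod_cast hp.pos
  have hq : ‖a‖ * ℓ < 1 := by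
    have := mul_lt_mul_of_pos_right ha hℓ
    rwa [inv_mul_cancel₀ hℓ.ne'] at this
  have hq0 : 0 ≤ ‖a‖ * ℓ := by positivity
  have hs := hasSum_exp ha
  have hs2 : HasSum (fun n : ℕ => a ^ (n + 2) / ((n + 2) ! : E)) (exp a - 1 - a) := by
    have h := (hasSum_nat_add_iff' 2).mpr hs
    simp only [Finset.sum_range_succ, Finset.sum_range_zero, zero_add, pow_zero,
      Nat.factorial_zero, Nat.cast_one, div_one, pow_one, Nat.factorial_one] at h
    rw [show exp a - 1 - a = exp a - (1 + a) by ring]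
    exact h
  rw [← hs2.tsum_eq]
  refine IsUltrametricDist.norm_tsum_le_of_forall_le_of_nonneg (by positivity) fun n => ?_
  calc ‖a ^ (n + 2) / ((n + 2)! : E)‖ ≤ ‖a‖ * (‖a‖ * ℓ) ^ (n + 2 - 1) :=
        norm_pow_div_factorial_le_mul_pow (n + 2) (by omega)
    _ ≤ ‖a‖ * (‖a‖ * ℓ) ^ 1 := by
        refine mul_le_mul_of_nonneg_left ?_ (norm_nonneg _)
        exact pow_le_pow_of_le_one hq0 hq.le (by omega)
    _ = ‖a‖ * (‖a‖ * ℓ) := by rw [pow_one]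

/-- `‖exp a - 1 - a‖ < ‖a‖` for `0 < ‖a‖ < ℓ⁻¹`. [folklore] -/
theorem norm_exp_sub_one_sub_self_lt {a : E} (ha : ‖a‖ < (ℓ : ℝ)⁻¹) (ha0 : a ≠ 0) :
    ‖exp a - 1 - a‖ < ‖a‖ := by
  have hp : ℓ.Prime := Fact.out
  have hℓ : (0 : ℝ) < ℓ := by exact_mod_cast hp.pos
  have hq : ‖a‖ * ℓ < 1 := by
    have := mul_lt_mul_of_pos_right ha hℓ
    rwa [inv_mul_cancel₀ hℓ.ne'] at this
  calc ‖exp a - 1 - a‖ ≤ ‖a‖ * (‖a‖ * ℓ) := norm_exp_sub_one_sub_self_le ha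
    _ < ‖a‖ * 1 := mul_lt_mul_of_pos_left hq (norm_pos_iff.mpr ha0)
    _ = ‖a‖ := mul_one _

/-- **`‖exp a - 1‖ = ‖a‖`** on the ball (ultrametric: `exp a - 1 = a + (smaller)`). [folklore] -/
theorem norm_exp_sub_one {a : E} (ha : ‖a‖ < (ℓ : ℝ)⁻¹) : ‖exp a - 1‖ = ‖a‖ := by
  by_cases ha0 : a = 0
  · subst ha0; simp
  have h := norm_exp_sub_one_sub_self_lt ha ha0
  have : exp a - 1 = (exp a - 1 - a) + a := by ring
  rw [this]
  exact IsUltrametricDist.norm_add_eq_max_of_norm_ne_norm h.ne ▸ max_eq_right h.le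

/-- **`‖exp a‖ = 1`** on the ball. [folklore] -/
theorem norm_exp {a : E} (ha : ‖a‖ < (ℓ : ℝ)⁻¹) : ‖exp a‖ = 1 := by
  have hp : ℓ.Prime := Fact.out
  have h1 : ‖exp a - 1‖ < 1 := by
    rw [norm_exp_sub_one ha]
    exact ha.trans_le (inv_le_one_of_one_le₀ (by exact_mod_cast hp.one_lt.le))
  have : exp a = (exp a - 1) + 1 := by ring
  rw [this]
  have hne : ‖exp a - 1‖ ≠ ‖(1 : E)‖ := by rw [norm_one]; exact h1.ne
  rw [IsUltrametricDist.norm_add_eq_max_of_norm_ne_norm hne, norm_one, max_eq_right h1.le]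

/-- `exp a ≠ 0` on the ball. [folklore] -/
theorem exp_ne_zero {a : E} (ha : ‖a‖ < (ℓ : ℝ)⁻¹) : exp a ≠ 0 := by
  intro h
  have := norm_exp ha
  rw [h, norm_zero] at this
  exact zero_ne_one this

/-- `exp a = 1 ↔ a = 0` on the ball. [folklore] -/
theorem exp_eq_one_iff {a : E} (ha : ‖a‖ < (ℓ : ℝ)⁻¹) : exp a = 1 ↔ a = 0 := by
  refine ⟨fun h => ?_, fun h => by rw [h, exp_zero]⟩
  have := norm_exp_sub_one ha
  rw [h, sub_self, norm_zero] at this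
  exact norm_eq_zero.mp this.symm

omit [IsUltrametricDist E] in
/-- `exp (-a) = (exp a)⁻¹` on the ball. [folklore] -/
theorem exp_neg {a : E} (ha : ‖a‖ < (ℓ : ℝ)⁻¹) : exp (-a) = (exp a)⁻¹ := by
  have hna : ‖-a‖ < (ℓ : ℝ)⁻¹ := by rwa [norm_neg]
  have h : exp a * exp (-a) = 1 := by rw [← exp_add ha hna, add_neg_cancel, exp_zero]
  exact (eq_inv_of_mul_eq_one_right h)

/-- **`exp` is injective on the ball** `‖·‖ < ℓ⁻¹`. [folklore] -/
theorem exp_injOn : Set.InjOn (exp : E → E) {a : E | ‖a‖ < (ℓ : ℝ)⁻¹} := by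
  intro a ha b hb hab
  have hnb : ‖-b‖ < (ℓ : ℝ)⁻¹ := by rw [norm_neg]; exact hb
  have hab' : ‖a + -b‖ < (ℓ : ℝ)⁻¹ :=
    (IsUltrametricDist.norm_add_le_max a (-b)).trans_lt (max_lt ha hnb)
  have h1 : exp (a + -b) = 1 := by
    rw [exp_add ha hnb, exp_neg hb, hab, mul_inv_cancel₀ (exp_ne_zero hb)]
  have := (exp_eq_one_iff hab').mp h1
  rwa [← sub_eq_add_neg, sub_eq_zero] at this

omit [IsUltrametricDist E] in
/-- `exp (z a) = (exp a)^z` for `z ∈ ℤ` on the ball. [folklore] -/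
theorem exp_intCast_mul {a : E} (ha : ‖a‖ < (ℓ : ℝ)⁻¹) (z : ℤ) :
    exp ((z : E) * a) = exp a ^ z := by
  obtain ⟨n, rfl | rfl⟩ := z.eq_nat_or_neg
  · rw [Int.cast_natCast, exp_natCast_mul ha, zpow_natCast]
  · have hn : ‖(n : E) * a‖ < (ℓ : ℝ)⁻¹ := by
      rw [norm_mul]
      exact (mul_le_of_le_one_left (norm_nonneg _) (norm_natCast_le_one (ℓ := ℓ) n)).trans_lt ha
    rw [Int.cast_neg, Int.cast_natCast, neg_mul, exp_neg hn, exp_natCast_mul ha, zpow_neg,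
      zpow_natCast]

/-! ### Local surjectivity at `1` -/

omit [IsUltrametricDist E] in
include ℓ in
/-- **Local surjectivity of `exp` at `1`.**  For every `ε > 0` there is `δ > 0` such that every
`w` with `‖w - 1‖ < δ` is of the form `exp c` with `‖c‖ < ε`: the exponential has strict
derivative `1` at `0` (Mathlib `hasStrictFDerivAt_exp_zero_of_radius_pos`), so by the inverse
function theorem it maps neighbourhoods of `0` onto neighbourhoods of `1`
(`HasStrictFDerivAt.map_nhds_eq_of_equiv`). [folklore] -/
theorem exists_forall_exists_exp_eq {ε : ℝ} (hε : 0 < ε) :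
    ∃ δ : ℝ, 0 < δ ∧ ∀ w : E, ‖w - 1‖ < δ → ∃ c : E, ‖c‖ < ε ∧ exp c = w := by
  have hder : HasStrictFDerivAt (exp : E → E)
      ((ContinuousLinearEquiv.refl ℚ_[ℓ] E : E ≃L[ℚ_[ℓ]] E) : E →L[ℚ_[ℓ]] E) 0 := by
    have h := hasStrictFDerivAt_exp_zero_of_radius_pos (𝕂 := ℚ_[ℓ]) (𝔸 := E)
      (expSeries_radius_pos (ℓ := ℓ))
    convert h using 1
    rw [ContinuousLinearEquiv.coe_refl, ContinuousLinearMap.one_def]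
  have hmap := hder.map_nhds_eq_of_equiv
  rw [exp_zero] at hmap
  have hball : exp '' ball (0 : E) ε ∈ 𝓝 (1 : E) := by
    rw [← hmap]
    exact image_mem_map (ball_mem_nhds 0 hε)
  obtain ⟨δ, hδ, hsub⟩ := Metric.mem_nhds_iff.mp hball
  refine ⟨δ, hδ, fun w hw => ?_⟩
  have hw' : w ∈ ball (1 : E) δ := by rwa [mem_ball, dist_eq_norm]
  obtain ⟨c, hc, hcw⟩ := hsub hw'
  exact ⟨c, by rwa [mem_ball, dist_zero_right] at hc, hcw⟩

end Ultra

end PadicExp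

end Literature.NumberTheory.Transcendental

end
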